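import Summits.ValiantsHypothesis.ValiantsHypothesis.Theorems.BarrierLeverChowHitsPartitionMinorsRStarvedRanks

/-!
# Route BarrierLever — item `ChowHitsPartitionMinorsR` (stmt-ValiantsHypothesis-21882), STARVED DESIGN X:
# THEOREM A′ — the starved pairs are hit by the starved design (rank dispatch and span transfer)

Helper file (`--supports stmt-ValiantsHypothesis-21882`; cell valiant-natproofs, rung V4, 𝒟-side; prover seat val-np-p5
gen 31). Closes NO item. Tenth and last file of the kernel chain for THEOREM A′ of memo MEMO-21882-valnp5-g31.md §3/§5.

**THEOREM A′ (`chowHits_of_starved`, `det_starvedDesign_ne_zero`).** Let `w : Fin r → Finset (Fin h)` be injective and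
face-closed with `|w k| ≤ 3`, `u : Fin r → Finset (Fin h)` injective onto the sets of size `≤ 2`, and let the pair be
STARVED with respect to `O ⊆ Fin h`: every 3-column avoids `O`, and the non-edges (pairs that are not columns) are exactly
the pairs `{α j, β j} ⊆ O` matched injectively with the 3-columns `j`. Then the product of the `h + #(3-columns)` affine
forms `1 + x_a + y_a` (`a : Fin h`) and `1 + x_{α j} + x_{β j} + Σ_{c ∈ w j} y_c` has NONZERO partition minor on `(u, w)`.
This class contains every layout on which all `h + h`-form designs die (`ChowStarvedPairs.exists_starvedPair`, p722854):
the residual node of line `affine_lower` has an honest `Θ(h²)`-form ∀h member family.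

Proof: `pMat_vanish` (the rank dispatch over the tables of `…RStarvedPivots/Det/Facts/Span/Ranks`) +
`det_ne_zero_of_rankTriangular` ⇒ the row-reduced matrix is nonsingular; `det_ne_zero_of_rows_mem_span` ⇒ the
`ρ̂`-matrix is; `det_partitionMatrix_prod_ne_zero_iff` (normal form) ⇒ the design's partition matrix is.

WHAT THIS IS NOT: item 21882 (all layouts) is NOT closed; nothing on crux stmt-ValiantsHypothesis-14610 or on `VP` versus `VNP`.
-/

set_option linter.dupNamespace false

namespace Summit.ValiantsHypothesis.ValiantsHypothesis.Theorems.BarrierLever.ChowStarvedDesign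

open Finset MvPolynomial

noncomputable section

variable {h r : ℕ}

section Assembly

variable (w : Fin r → Finset (Fin h)) (O : Finset (Fin h)) (α β : {j : Fin r // (w j).card = 3} → Fin h)
  (u : Fin r → Finset (Fin h)) (hw3 : ∀ k, (w k).card ≤ 3) (hucov : ∀ U : Finset (Fin h), U.card ≤ 2 → ∃ i, u i = U)
  (hw : Function.Injective w) (hu : Function.Injective u)
  (hne : ∀ j : {j : Fin r // (w j).card = 3}, ∀ k, w k ≠ {α j, β j})
  (hinjE : ∀ j j' : {j : Fin r // (w j).card = 3}, ({α j, β j} : Finset (Fin h)) = {α j', β j'} → j = j')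
  (hα : ∀ j, α j ∈ O) (hβ : ∀ j, β j ∈ O) (hαβ : ∀ j, α j ≠ β j)
  (hK : ∀ j : {j : Fin r // (w j).card = 3}, ∀ c ∈ w j.1, c ∉ O)

/-! ## 6. Vanishing above the pivots -/

variable (hsurj : ∀ a b : Fin h, a ≠ b → (∀ k, w k ≠ {a, b}) →
    ∃ j : {j : Fin r // (w j).card = 3}, ({α j, β j} : Finset (Fin h)) = {a, b})
  (hu2 : ∀ i, (u i).card ≤ 2)

include hα hβ in
/-- A pair with an element outside `O` is unmatched. -/
theorem unmatched_of_not_mem {x y : Fin h} (hx : x ∉ O) :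
    ∀ j : {j : Fin r // (w j).card = 3}, ({α j, β j} : Finset (Fin h)) ≠ {x, y} := by
  intro j e
  have hx' : x ∈ ({α j, β j} : Finset (Fin h)) := by rw [e]; simp
  simp only [Finset.mem_insert, Finset.mem_singleton] at hx'
  rcases hx' with h1 | h1
  · exact hx (h1 ▸ hα j)
  · exact hx (h1 ▸ hβ j)

include hw hu hne hinjE hα hβ hαβ hK hsurj hu2 in
/-- **Vanishing**: a non-pivot entry in a column whose pivot row has rank `≤` the row's rank is zero. -/
theorem pMat_vanish (i k : Fin r) (hik : i ≠ pivEquiv w α β u hw3 hucov hw hne hinjE k)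
    (hrk : rowRank w O (u (pivEquiv w α β u hw3 hucov hw hne hinjE k)) ≤ rowRank w O (u i)) :
    coeff (∑ a' ∈ (∅ : Finset (Fin h)), Finsupp.single (Fin.castAdd h a') 1 +
        ∑ c ∈ w k, Finsupp.single (Fin.natAdd h c) 1) (pPoly w α β (u i)) = 0 := by
  have hne_face : u i ≠ pivFace w α β k := by
    intro e
    apply hik
    apply hu
    rw [e, u_pivEquiv w α β u hw3 hucov hw hne hinjE k]
  rw [u_pivEquiv w α β u hw3 hucov hw hne hinjE k] at hrk
  unfold pivFace at hrk hne_face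
  by_cases hk : (w k).card = 3
  · ---- 3-columns: pivot row = the matched non-edge, rank 4
    rw [dif_pos hk] at hrk hne_face
    rw [rowRank_pair_OO_ncol w O (hαβ ⟨k, hk⟩) (hα _) (hβ _) (fun ⟨k', e⟩ => hne ⟨k, hk⟩ k' e)] at hrk
    rcases thin_cases (u i) (hu2 i) with h0 | ⟨v, hv⟩ | ⟨x, y, hxy, hxy'⟩
    · rw [h0, rowRank_empty] at hrk; omega
    · rw [hv] at hrk ⊢
      by_cases hvO : v ∈ O
      · rw [rowRank_single_O w O hvO] at hrk; omega
      · rw [pPoly_singleton, coeff_rr_three w α β v (w k) hk, inc_eq_zero_of_not_mem w O α β hα hβ hvO]; simp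
    · rw [hxy'] at hrk hne_face ⊢
      by_cases hxO : x ∈ O <;> by_cases hyO : y ∈ O
      · by_cases hcol : ∃ k', w k' = {x, y}
        · rw [rowRank_pair_OO_col w O hxy hxO hyO hcol] at hrk; omega
        · obtain ⟨j'', hj''⟩ := hsurj x y hxy (fun k' e => hcol ⟨k', e⟩)
          rw [pPoly_pair_matched w α β hinjE j'' x y hxy hj'',
            show w k = w (⟨k, hk⟩ : {j : Fin r // (w j).card = 3}).1 from rfl,
            coeff_pNE_triple w O α β hα hβ hK hw j'' ⟨k, hk⟩, if_neg]
          intro e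
          apply hne_face
          rw [← hj'', ← e]
      · rw [Finset.pair_comm, rowRank_pair_mixed w O hyO hxO] at hrk; omega
      · rw [rowRank_pair_mixed w O hxO hyO] at hrk; omega
      · rw [pPoly_pair_unmatched w α β x y hxy (unmatched_of_not_mem w O α β hα hβ hxO),
          coeff_rr_mul_rr_threeK w O α β hα hβ x y hxO hyO (w k) hk]
  · ---- thin columns: pivot row = the column itself
    rw [dif_neg hk] at hrk hne_face
    rcases thin_cases (w k) (by have := hw3 k; omega) with h0 | ⟨c, hc⟩ | ⟨x', y', hxy', hW⟩
    · -- column `∅`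
      rw [h0] at hne_face ⊢
      rcases thin_cases (u i) (hu2 i) with hu0 | ⟨v, hv⟩ | ⟨x, y, hxy, hxyU⟩
      · exact absurd hu0 hne_face
      · rw [hv, pPoly_singleton, coeff_rr_empty]
      · rw [hxyU]
        by_cases hmat : ∃ j : {j : Fin r // (w j).card = 3}, ({α j, β j} : Finset (Fin h)) = {x, y}
        · obtain ⟨j, hj⟩ := hmat
          rw [pPoly_pair_matched w α β hinjE j x y hxy hj]
          exact coeff_pNE_small w O α β hK j ∅ (by simp) (by simp)
        · push Not at hmat
          rw [pPoly_pair_unmatched w α β x y hxy hmat]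
          exact coeff_rr_mul_rr_le_one w α β x y ∅ (by simp)
    · -- singleton column `{c}`
      rw [hc] at hne_face hrk ⊢
      rcases thin_cases (u i) (hu2 i) with hu0 | ⟨v, hv⟩ | ⟨x, y, hxy, hxyU⟩
      · rw [hu0, rowRank_empty] at hrk
        by_cases hcO : c ∈ O
        · rw [rowRank_single_O w O hcO] at hrk; omega
        · rw [rowRank_single_K w O hcO] at hrk; omega
      · rw [hv] at hne_face ⊢
        have hvc : c ≠ v := fun e => hne_face (by rw [e])
        rw [pPoly_singleton, coeff_rr_single, if_neg hvc]
        by_cases hcO : c ∈ O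
        · rw [inc_eq_zero_of_mem w O α β hK hcO (Finset.mem_singleton_self c) v]; simp
        · by_cases hvO : v ∈ O
          · rw [hv, rowRank_single_K w O hcO, rowRank_single_O w O hvO] at hrk; omega
          · rw [inc_eq_zero_of_not_mem w O α β hα hβ hvO]; simp
      · rw [hxyU] at hrk ⊢
        by_cases hmat : ∃ j : {j : Fin r // (w j).card = 3}, ({α j, β j} : Finset (Fin h)) = {x, y}
        · obtain ⟨j, hj⟩ := hmat
          by_cases hcO : c ∈ O
          · rw [pPoly_pair_matched w α β hinjE j x y hxy hj]
            exact coeff_pNE_small w O α β hK j {c} (by simp) (fun c' hc' => by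
              rw [Finset.mem_singleton.mp hc']; exact hcO)
          · -- matched pairs have rank 4 < 5
            have hxO : x ∈ O := by
              have : x ∈ ({α j, β j} : Finset (Fin h)) := by rw [hj]; simp
              simp only [Finset.mem_insert, Finset.mem_singleton] at this
              rcases this with e | e
              · exact e ▸ hα j
              · exact e ▸ hβ j
            have hyO : y ∈ O := by
              have : y ∈ ({α j, β j} : Finset (Fin h)) := by rw [hj]; simp
              simp only [Finset.mem_insert, Finset.mem_singleton] at this
              rcases this with e | e
              · exact e ▸ hα j
              · exact e ▸ hβ j
            rw [rowRank_single_K w O hcO, rowRank_pair_OO_ncol w O hxy hxO hyO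
              (fun ⟨k', e⟩ => hne j k' (by rw [e, hj]))] at hrk
            omega
        · push Not at hmat
          rw [pPoly_pair_unmatched w α β x y hxy hmat]
          exact coeff_rr_mul_rr_le_one w α β x y {c} (by simp)
    · -- pair column `{x', y'}`
      rw [hW] at hne_face hrk ⊢
      rcases thin_cases (u i) (hu2 i) with hu0 | ⟨v, hv⟩ | ⟨x, y, hxy, hxyU⟩
      · rw [hu0, rowRank_empty] at hrk
        exfalso
        revert hrk
        unfold rowRank
        rw [if_neg (by rw [Finset.card_pair hxy']; omega), if_neg (by rw [Finset.card_pair hxy']; omega)]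
        split_ifs <;> omega
      · -- singleton rows reaching a pair column have rank 5: `v ∉ O`
        rw [hv] at hrk ⊢
        by_cases hvO : v ∈ O
        · exfalso
          rw [rowRank_single_O w O hvO] at hrk
          revert hrk
          unfold rowRank
          rw [if_neg (by rw [Finset.card_pair hxy']; omega), if_neg (by rw [Finset.card_pair hxy']; omega)]
          split_ifs <;> omega
        · rw [pPoly_singleton, coeff_rr_two w α β v {x', y'} (Finset.card_pair hxy'),
            inc_eq_zero_of_not_mem w O α β hα hβ hvO]
          simp
      · rw [hxyU] at hrk hne_face ⊢
        by_cases hmat : ∃ j : {j : Fin r // (w j).card = 3}, ({α j, β j} : Finset (Fin h)) = {x, y}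
        · ---- matched (non-edge) rows
          obtain ⟨j, hj⟩ := hmat
          rw [pPoly_pair_matched w α β hinjE j x y hxy hj]
          by_cases hx'O : x' ∈ O <;> by_cases hy'O : y' ∈ O
          · exact coeff_pNE_pairO w O α β hα hβ hK j {x', y'} (Finset.card_pair hxy')
              (fun c hc => by
                simp only [Finset.mem_insert, Finset.mem_singleton] at hc
                rcases hc with rfl | rfl
                · exact hx'O
                · exact hy'O)
              (fun e => hne j k (by rw [hW, e]))
          · rw [Finset.pair_comm x' y']
            exact coeff_pNE_mixed w O α β hα hβ hK j y' x' hy'O hx'O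
          · exact coeff_pNE_mixed w O α β hα hβ hK j x' y' hx'O hy'O
          · -- K–K columns have rank 6 > 4
            exfalso
            have hxO : x ∈ O := by
              have : x ∈ ({α j, β j} : Finset (Fin h)) := by rw [hj]; simp
              simp only [Finset.mem_insert, Finset.mem_singleton] at this
              rcases this with e | e
              · exact e ▸ hα j
              · exact e ▸ hβ j
            have hyO : y ∈ O := by
              have : y ∈ ({α j, β j} : Finset (Fin h)) := by rw [hj]; simp
              simp only [Finset.mem_insert, Finset.mem_singleton] at this
              rcases this with e | e
              · exact e ▸ hα j
              · exact e ▸ hβ j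
            rw [rowRank_pair_KK w O hxy' hx'O hy'O, rowRank_pair_OO_ncol w O hxy hxO hyO
              (fun ⟨k', e⟩ => hne j k' (by rw [e, hj]))] at hrk
            omega
        · ---- unmatched (edge) rows
          push Not at hmat
          rw [pPoly_pair_unmatched w α β x y hxy hmat]
          by_cases hx'O : x' ∈ O <;> by_cases hy'O : y' ∈ O
          · -- O–O column
            rw [coeff_rr_mul_rr_pairO w O α β hK x y {x', y'} (Finset.card_pair hxy')
              (fun c hc => by
                simp only [Finset.mem_insert, Finset.mem_singleton] at hc
                rcases hc with rfl | rfl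
                · exact hx'O
                · exact hy'O), if_neg]
            rintro ⟨hyW, he⟩
            exact hne_face (eq_pair_of_erase hyW he).symm
          · -- mixed column `{x', y'}` with `x' ∈ O`, `y' ∉ O`
            have hnotboth : ¬ (x ∈ O ∧ y ∈ O) := by
              rintro ⟨hxO, hyO⟩
              have hcol : ∃ k', w k' = {x, y} := by
                by_contra hc
                push Not at hc
                obtain ⟨j, hj⟩ := hsurj x y hxy hc
                exact hmat j hj
              rw [rowRank_pair_OO_col w O hxy hxO hyO hcol, Finset.pair_comm, rowRank_pair_mixed w O hy'O hx'O] at hrk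
              omega
            rw [Finset.pair_comm x' y']
            exact coeff_rr_mul_rr_mixed_eq_zero w O α β hα hβ hK x y y' x' hy'O hx'O hnotboth
              (fun e => hne_face (e.trans (Finset.pair_comm y' x')))
          · -- mixed column with `x' ∉ O`, `y' ∈ O`
            have hnotboth : ¬ (x ∈ O ∧ y ∈ O) := by
              rintro ⟨hxO, hyO⟩
              have hcol : ∃ k', w k' = {x, y} := by
                by_contra hc
                push Not at hc
                obtain ⟨j, hj⟩ := hsurj x y hxy hc
                exact hmat j hj
              rw [rowRank_pair_OO_col w O hxy hxO hyO hcol, rowRank_pair_mixed w O hx'O hy'O] at hrk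
              omega
            exact coeff_rr_mul_rr_mixed_eq_zero w O α β hα hβ hK x y x' y' hx'O hy'O hnotboth hne_face
          · -- K–K column: rows of rank ≥ 6 are K–K pairs
            rw [coeff_rr_mul_rr_pairK w O α β hα hβ x y ?_ ?_ {x', y'} (Finset.card_pair hxy'), if_neg]
            · rintro ⟨hyW, he⟩
              exact hne_face (eq_pair_of_erase hyW he).symm
            · intro hxO
              rw [rowRank_pair_KK w O hxy' hx'O hy'O] at hrk
              have := rowRank_le w O ({x, y} : Finset (Fin h))
              -- rank 6 forces `x, y ∉ O`
              revert hrk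
              unfold rowRank
              rw [if_neg (by rw [Finset.card_pair hxy]; omega), if_neg (by rw [Finset.card_pair hxy]; omega)]
              split_ifs with h1 h2 h3 <;> first | omega | (intro; exact absurd ⟨x, by simp, hxO⟩ h3)
            · intro hyO
              revert hrk
              rw [rowRank_pair_KK w O hxy' hx'O hy'O]
              unfold rowRank
              rw [if_neg (by rw [Finset.card_pair hxy]; omega), if_neg (by rw [Finset.card_pair hxy]; omega)]
              split_ifs with h1 h2 h3 <;> first | omega | (intro; exact absurd ⟨y, by simp, hyO⟩ h3)

/-! ## 7. THEOREM A′ -/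

variable (hloww : ∀ j T, T ⊆ w j → ∃ k, w k = T)

include hw3 hucov hw hu hne hinjE hα hβ hαβ hK hsurj hu2 in
/-- The row-reduced matrix `[coeff_{w k} pPoly (u i)]` is nonsingular (rank-triangular). -/
theorem det_pMat_ne_zero :
    (Matrix.of fun i k : Fin r => coeff (∑ a' ∈ (∅ : Finset (Fin h)), Finsupp.single (Fin.castAdd h a') 1 +
        ∑ c ∈ w k, Finsupp.single (Fin.natAdd h c) 1) (pPoly w α β (u i))).det ≠ 0 := by
  refine det_ne_zero_of_rankTriangular (fun i => rowRank w O (u i)) 6 (fun i => rowRank_le w O (u i))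
    (pivEquiv w α β u hw3 hucov hw hne hinjE) _ (fun i k hik => ?_) (fun k => ?_)
  · by_contra hcon
    push Not at hcon
    exact hik (by
      rw [Matrix.of_apply]
      exact pMat_vanish w O α β u hw3 hucov hw hu hne hinjE hα hβ hαβ hK hsurj hu2 i k hcon.1 hcon.2)
  · rw [Matrix.of_apply]
    exact pMat_diag w O α β u hw3 hucov hw hne hinjE hα hβ hαβ hK k

include hw3 hucov hw hu hne hinjE hα hβ hαβ hK hsurj hu2 in
/-- The `ρ̂`-matrix `[coeff_{w k} rowPoly (u i)]` is nonsingular (span transfer from the row-reduced matrix). -/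
theorem det_rhoMat_ne_zero :
    (Matrix.of fun i k : Fin r => coeff (∑ a' ∈ (∅ : Finset (Fin h)), Finsupp.single (Fin.castAdd h a') 1 +
        ∑ c ∈ w k, Finsupp.single (Fin.natAdd h c) 1) (rowPoly (desA w α β) (desB w) Finset.univ (u i))).det ≠ 0 := by
  classical
  -- the coefficient map onto the columns
  let Φ : MvPolynomial (Fin (h + h)) ℂ →ₗ[ℂ] (Fin r → ℂ) :=
    LinearMap.pi fun k => lcoeff ℂ (∑ a' ∈ (∅ : Finset (Fin h)), Finsupp.single (Fin.castAdd h a') 1 +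
        ∑ c ∈ w k, Finsupp.single (Fin.natAdd h c) 1)
  have hΦ : ∀ q k, Φ q k = coeff (∑ a' ∈ (∅ : Finset (Fin h)), Finsupp.single (Fin.castAdd h a') 1 +
        ∑ c ∈ w k, Finsupp.single (Fin.natAdd h c) 1) q := fun q k => rfl
  have hP := det_pMat_ne_zero w O α β u hw3 hucov hw hu hne hinjE hα hβ hαβ hK hsurj hu2
  have key := det_ne_zero_of_rows_mem_span Φ (fun i => rowPoly (desA w α β) (desB w) Finset.univ (u i))
    (fun i => pPoly w α β (u i)) ?_ (by simpa only [hΦ] using hP)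
  · simpa only [hΦ] using key
  -- every row-reduced polynomial is a combination of the `ρ̂`-rows
  intro i
  -- the generators of `rowSpan` are rows
  have hsub : rowSpan w α β ≤ Submodule.span ℂ (Set.range fun i => rowPoly (desA w α β) (desB w) Finset.univ (u i)) := by
    apply Submodule.span_le.mpr
    rintro q (⟨(rfl : q = 1) | ⟨v, rfl⟩⟩ | ⟨pq, rfl⟩)
    · obtain ⟨i₀, hi₀⟩ := hucov ∅ (by simp)
      exact Submodule.subset_span ⟨i₀, by simp only [hi₀, rowPoly_empty]⟩
    · obtain ⟨i₀, hi₀⟩ := hucov {v} (by simp)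
      exact Submodule.subset_span ⟨i₀, by simp only [hi₀, rowPoly_singleton]⟩
    · obtain ⟨i₀, hi₀⟩ := hucov {pq.1.1, pq.1.2} (by rw [Finset.card_pair pq.2])
      exact Submodule.subset_span ⟨i₀, by simp only [hi₀, rowPoly_pair _ _ _ _ _ pq.2]⟩
  apply hsub
  rcases thin_cases (u i) (hu2 i) with h0 | ⟨v, hv⟩ | ⟨x, y, hxy, hxy'⟩
  · rw [h0, pPoly_empty]; exact one_mem_rowSpan w α β
  · rw [hv, pPoly_singleton]; exact rr_mem_rowSpan w α β v
  · rw [hxy']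
    by_cases hmat : ∃ j : {j : Fin r // (w j).card = 3}, ({α j, β j} : Finset (Fin h)) = {x, y}
    · obtain ⟨j, hj⟩ := hmat
      rw [pPoly_pair_matched w α β hinjE j x y hxy hj]
      exact pNE_mem_rowSpan w O α β hα hβ hK hαβ hinjE j
    · push Not at hmat
      rw [pPoly_pair_unmatched w α β x y hxy hmat]
      exact rr_mul_rr_mem_rowSpan w α β x y hxy hmat

include hw3 hucov hw hu hne hinjE hα hβ hαβ hK hsurj hu2 hloww in
/-- **THEOREM A′ (memo MEMO-21882-valnp5-g31.md §3): the starved design hits the starved pair.** The partition matrix of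
`∏_a (1 + x_a + y_a) · ∏_{j} (1 + x_{α j} + x_{β j} + Σ_{c ∈ w j} y_c)` on (thin rows `u`) × (columns `w`) is nonsingular. -/
theorem det_starvedDesign_ne_zero :
    (Matrix.of fun i k : Fin r => coeff (∑ a ∈ u i, Finsupp.single (Fin.castAdd h a) 1 +
        ∑ c ∈ w k, Finsupp.single (Fin.natAdd h c) 1)
      (∏ k ∈ (Finset.univ : Finset (Fin h ⊕ {j : Fin r // (w j).card = 3})),
        ((C 1 + ∑ a, C (desA w α β k a) * X (Fin.castAdd h a) + ∑ c, C (desB w k c) * X (Fin.natAdd h c)) :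
          MvPolynomial (Fin (h + h)) ℂ))).det ≠ 0 :=
  (det_partitionMatrix_prod_ne_zero_iff (desA w α β) (desB w) Finset.univ u w hu2 hw hloww hw3).mpr
    (det_rhoMat_ne_zero w O α β u hw3 hucov hw hu hne hinjE hα hβ hαβ hK hsurj hu2)

include hw3 hucov hw hu hne hinjE hα hβ hαβ hK hsurj hu2 hloww in
/-- **THEOREM A′, item form**: the starved pair is hit by a product of `h + #(3-columns)` affine forms. -/
theorem chowHits_of_starved :
    ∃ ℓ : Fin (h + Fintype.card {j : Fin r // (w j).card = 3}) → MvPolynomial (Fin (h + h)) ℂ,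
      (∀ k, (ℓ k).totalDegree ≤ 1) ∧
      (Matrix.of fun i k : Fin r => coeff (∑ a ∈ u i, Finsupp.single (Fin.castAdd h a) 1 +
          ∑ c ∈ w k, Finsupp.single (Fin.natAdd h c) 1) (∏ k, ℓ k)).det ≠ 0 := by
  classical
  let e : (Fin h ⊕ {j : Fin r // (w j).card = 3}) ≃ Fin (h + Fintype.card {j : Fin r // (w j).card = 3}) :=
    (Fintype.equivFin _).trans (finCongr (by rw [Fintype.card_sum, Fintype.card_fin]))
  let form : (Fin h ⊕ {j : Fin r // (w j).card = 3}) → MvPolynomial (Fin (h + h)) ℂ := fun k =>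
    C 1 + ∑ a, C (desA w α β k a) * X (Fin.castAdd h a) + ∑ c, C (desB w k c) * X (Fin.natAdd h c)
  refine ⟨fun k => form (e.symm k), fun k => ChowXStar.totalDegree_fullAffine_le _ _ _, ?_⟩
  have hprod : (∏ k, form (e.symm k)) = ∏ k ∈ (Finset.univ : Finset (Fin h ⊕ {j : Fin r // (w j).card = 3})), form k :=
    Fintype.prod_equiv e.symm _ _ (fun k => rfl)
  rw [hprod]
  exact det_starvedDesign_ne_zero w O α β u hw3 hucov hw hu hne hinjE hα hβ hαβ hK hsurj hu2 hloww

end Assembly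

end

end Summit.ValiantsHypothesis.ValiantsHypothesis.Theorems.BarrierLever.ChowStarvedDesign
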